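import Summits.QuantumFields.BalabanUV.T4Continuum.Support.RegularTransportersContour

/-!
# T⁴ programme, spine node NE2 (U1a), tier B row B3.b-conc (ii) — NESTED-CONTOUR TRANSPORT, file 3: the CLOSED FORM `thetaC ≤ θ₀/n`
# at the tower sizes (fine per-bond size `α/(L·n)`, coarse `α/n`, per-bond connection consistency `β/(L·n²)`)

NE2 formalisation swarm `b2b-balaban-t4-ne2-formalise-*`, seat leaf-06, companion of `Support/NestedContourTransport{,Contour}` (row B3.b-conc
(ii) of `t4/formal/NE2/LEAVES.md`).  File 2's END `transport_contour_two_level` bounds the two-level defect of the contour transporters by the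
explicit `thetaC L n d a′ a b`; leaf-07's tower corollary `averagingLaws_Ecov_geom` (row B3.b-conc (iii), journal l.6328) consumes a GEOMETRIC
majorant `θ k ≤ θ₀·L^{−k}`.  This file supplies it: with `n = L^k` fine sites per unit length at the coarse level,

 * **`one_add_pow_sub_linear_le`** (the binomial second-order remainder `(1 + y)^L − 1 − Ly ≤ (Ly)²/2·(1 + y)^L`);
 * **`thetaC_le_theta0_div`**: `thetaC L n d (α/(L·n)) (α/n) (β/(L·n²)) ≤ theta0 d α β / n` for `L, n ≥ 1`, `α, β ≥ 0`, with
   **`theta0 d α β = e^{2(d+1)α}·((d+1)·e^{4α}·(α²e^{α}/2 + β + α·e^{α}) + 2α·e^{α} + α)`** — linear in the NE3-currency constant `β`,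
   `O(α)` in the regularity constant `α`, no dependence on `L` or `n` beyond the displayed `1/n`;
 * (v1.1, §4) **`transport_contour_two_level_tower`**: the TOWER FORM of row B3.b-conc (ii) — for bond transporters
   `R k : Fin d → idx L M k → Matrix o o ℂ` with `‖R^{(k)}_ν(i) − 1‖ ≤ α/n_k` and `‖n_{k+1}•(R^{(k+1)}_ν(i) − 1) − n_k•(R^{(k)}_ν(parT i) − 1)‖
   ≤ β/n_k` (the `LipschitzBackgroundM.{bound, consistent}` shapes of `Support/ColourCovariantLaplacian`, the latter NE3's currency via
   `Support/NE2FromNE3`), leaf-07's `hT2` holds at every level with `θ k = theta0 d α β · L^{−k}`; `norm_transport_contour_sub_one_le`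
   (leaf-07's `hTτ` for every `s ≤ n` with `τ = e^{(d+1)α} − 1`, via leaf-03's `RegularTransportersContour.length_contour_le_of_le`); and
   **`transport_contour_two_level_of_regular_geom`** = leaf-03's `RegularTransportersContour.transport_contour_two_level_of_regular` (from
   the regularity class `RegularTransporters R α β` of row B5 and node NE3's `LocalRate` on `regClass R`, row B6, as DISPLAYED binders)
   made GEOMETRIC: `θ k = theta0 d α (betaNE3 o C) · L^{−k}`.

HONEST FRAMING (T4-DAG p. 1).  Elementary real inequalities about OUR constants ([folklore]); model level as in files 1–2 (transporters DATA,
consistency = NE3's currency as a hypothesis shape); ONE input (ii) of row B3.b-conc of the NE2 skeleton; NOT [B9] (3.19)/(3.26) as printed,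
NOT NE2, no B0; NOT infinite volume, NOT a mass gap, NOT Clay, NOT summit progress; spine 0/9 unchanged.  HONEST DEPENDENCY: continuum YM
on T⁴ ⇐ BetaPertH ∧ nine spine estimates (0/9 proved); BetaPertH ⇐ (D1) ∧ (D4) ∧ CAP+tail; G-an2-4 gates asym, D1 and NE2/3/4.  ABSOLUTE
RULE kept; no `sorry`.
-/

noncomputable section

open scoped BigOperators

namespace Summit.QuantumFields.BalabanUV.T4Continuum.NestedContourTransport

variable {d : ℕ}

/-! ## §3 The closed form: `thetaC ≤ θ₀/n` at `a′ = α/(Ln)`, `a = α/n`, `b = β/(Ln²)` -/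

section ClosedForm

/-- **the binomial second-order remainder**: `(1 + y)^L − 1 − L·y ≤ (L·y)²/2 · (1 + y)^L` for `y ≥ 0`. [folklore] -/
theorem one_add_pow_sub_linear_le {y : ℝ} (hy : 0 ≤ y) (L : ℕ) :
    (1 + y) ^ L - 1 - L * y ≤ (L * y) ^ 2 / 2 * (1 + y) ^ L := by
  induction L with
  | zero => simp
  | succ L ih =>
    have hP : 1 ≤ (1 + y) ^ L := one_le_pow₀ (by linarith)
    have e : (1 + y) ^ (L + 1) - 1 - ((L + 1 : ℕ) : ℝ) * y = (1 + y) * ((1 + y) ^ L - 1 - L * y) + L * y ^ 2 := by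
      push_cast; ring
    rw [e]
    have h1 : (1 + y) * ((1 + y) ^ L - 1 - L * y) ≤ (1 + y) * ((L * y) ^ 2 / 2 * (1 + y) ^ L) :=
      mul_le_mul_of_nonneg_left ih (by linarith)
    have h2 : (L : ℝ) * y ^ 2 ≤ (L + 1 / 2) * y ^ 2 * (1 + y) ^ (L + 1) := by
      have h3 : (L : ℝ) * y ^ 2 ≤ (L + 1 / 2) * y ^ 2 := by nlinarith [sq_nonneg y]
      have h4 : 1 ≤ (1 + y) ^ (L + 1) := one_le_pow₀ (by linarith)
      nlinarith [sq_nonneg y, mul_nonneg (by positivity : (0:ℝ) ≤ (L + 1/2) * y ^ 2) (sub_nonneg.mpr h4)]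
    calc (1 + y) * ((1 + y) ^ L - 1 - L * y) + L * y ^ 2
        ≤ (1 + y) * ((L * y) ^ 2 / 2 * (1 + y) ^ L) + (L + 1 / 2) * y ^ 2 * (1 + y) ^ (L + 1) := add_le_add h1 h2
      _ = (((L : ℝ) ^ 2 + 2 * L + 1) * y ^ 2 / 2) * (1 + y) ^ (L + 1) := by rw [pow_succ]; ring
      _ = (((L + 1 : ℕ) : ℝ) * y) ^ 2 / 2 * (1 + y) ^ (L + 1) := by push_cast; ring

/-- **THE CLOSED-FORM CONSTANT** `θ₀(d, α, β) = e^{2(d+1)α}·((d+1)·e^{4α}·(α²e^{α}/2 + β + α·e^{α}) + 2α·e^{α} + α)`. [folklore] -/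
def theta0 (d : ℕ) (α β : ℝ) : ℝ :=
  Real.exp (2 * (d + 1) * α) * ((d + 1) * Real.exp (4 * α) * (α ^ 2 * Real.exp α / 2 + β + α * Real.exp α) + 2 * (α * Real.exp α) + α)

/-- **`thetaC ≤ θ₀/n` AT THE TOWER SIZES**: fine per-bond size `α/(L·n)`, coarse per-bond size `α/n`, per-bond connection consistency
`β/(L·n²)` (`n ≥ 1`, `L ≥ 1`, `α, β ≥ 0`) — the geometric `θ₀·L^{−k}` shape (`n = L^k`) that leaf-07's `averagingLaws_Ecov_geom` consumes.
[folklore] -/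
theorem thetaC_le_theta0_div {L n : ℕ} (hL : 1 ≤ L) (hn : 1 ≤ n) (d : ℕ) {α β : ℝ} (hα : 0 ≤ α) (hβ : 0 ≤ β) :
    thetaC L n d (α / (L * n)) (α / n) (β / (L * n ^ 2)) ≤ theta0 d α β / n := by
  have hLr : (1 : ℝ) ≤ L := by exact_mod_cast hL
  have hnr : (1 : ℝ) ≤ n := by exact_mod_cast hn
  have hLpos : (0 : ℝ) < L := by linarith
  have hnpos : (0 : ℝ) < n := by linarith
  -- `(1 + y)^m ≤ e^{my}` and `e^x − 1 ≤ x e^x` (in the tree as `RSTProj.one_add_pow_le_exp` / `AreaLaw.exp_sub_one_le_mul_exp`, whose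
  -- module closures are foreign to this file; re-derived locally)
  have one_add_pow_le_exp_mul : ∀ {y : ℝ}, 0 ≤ y → ∀ m : ℕ, (1 + y) ^ m ≤ Real.exp (m * y) := by
    intro y hy m
    have h1 : 1 + y ≤ Real.exp y := by have := Real.add_one_le_exp y; linarith
    calc (1 + y) ^ m ≤ Real.exp y ^ m := pow_le_pow_left₀ (by linarith) h1 m
      _ = Real.exp (m * y) := by rw [← Real.exp_nat_mul]
  have exp_sub_one_le_mul_exp' : ∀ x : ℝ, Real.exp x - 1 ≤ x * Real.exp x := by
    intro x
    have h1 : 1 - x ≤ Real.exp (-x) := by have := Real.add_one_le_exp (-x); linarith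
    have h2 : Real.exp x * (1 - x) ≤ 1 := by
      calc Real.exp x * (1 - x) ≤ Real.exp x * Real.exp (-x) := mul_le_mul_of_nonneg_left h1 (Real.exp_nonneg x)
        _ = 1 := by rw [← Real.exp_add, add_neg_cancel, Real.exp_zero]
    nlinarith [Real.exp_nonneg x]
  set a' : ℝ := α / (L * n) with ha'
  set a : ℝ := α / n with haa
  set b : ℝ := β / (L * n ^ 2) with hbb
  have ha'0 : 0 ≤ a' := by positivity
  have ha0 : 0 ≤ a := by positivity
  have hb0 : 0 ≤ b := by positivity
  have hαn : α / n ≤ α := div_le_self hα hnr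
  have eLa' : (L : ℝ) * a' = α / n := by rw [ha']; field_simp
  have eLna' : ((L * n : ℕ) : ℝ) * a' = α := by rw [ha']; push_cast; field_simp
  have ena : (n : ℝ) * a = α := by rw [haa]; field_simp
  have eLb : (L : ℝ) * b = β / n ^ 2 := by rw [hbb]; field_simp
  -- exponential bounds
  have hE1 : (1 + a') ^ L ≤ Real.exp (α / n) := by rw [← eLa']; exact one_add_pow_le_exp_mul ha'0 L
  have hE1' : (1 + a') ^ L ≤ Real.exp α := hE1.trans (Real.exp_le_exp.mpr hαn)
  have hE2 : (1 + a') ^ (L * n) ≤ Real.exp α := by rw [← eLna']; exact one_add_pow_le_exp_mul ha'0 (L * n)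
  have hE3 : (1 + a) ^ n ≤ Real.exp α := by rw [← ena]; exact one_add_pow_le_exp_mul ha0 n
  have hE4 : (1 + a) ≤ Real.exp (α / n) := by
    have := one_add_pow_le_exp_mul ha0 1; simp only [pow_one, Nat.cast_one, one_mul] at this; rwa [haa] at this ⊢
  have hexpα : 1 ≤ Real.exp α := Real.one_le_exp hα
  have hexpαn : 1 ≤ Real.exp (α / n) := Real.one_le_exp (by positivity)
  -- Bl ≤ e^{2α}, Bc^{n+1} ≤ e^{4α}
  have hBl : Bl L n a' a ≤ Real.exp (2 * α) := by
    unfold Bl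
    calc (1 + a') ^ (L * n) * (1 + a) ^ n ≤ Real.exp α * Real.exp α :=
          mul_le_mul hE2 hE3 (pow_nonneg (by linarith) _) (Real.exp_nonneg _)
      _ = Real.exp (2 * α) := by rw [← Real.exp_add]; ring_nf
  have hBl1 : 1 ≤ Bl L n a' a := one_le_Bl (L := L) (n := n) ha'0 ha0
  have hBld : Bl L n a' a ^ (d + 1) ≤ Real.exp (2 * (d + 1) * α) := by
    calc Bl L n a' a ^ (d + 1) ≤ Real.exp (2 * α) ^ (d + 1) := pow_le_pow_left₀ (by linarith) hBl _
      _ = Real.exp (2 * (d + 1) * α) := by rw [← Real.exp_nat_mul]; push_cast; ring_nf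
  have hBc : Bc L a' a ≤ Real.exp (2 * (α / n)) := by
    unfold Bc
    calc (1 + a') ^ L * (1 + a) ≤ Real.exp (α / n) * Real.exp (α / n) := mul_le_mul hE1 hE4 (by linarith) (Real.exp_nonneg _)
      _ = Real.exp (2 * (α / n)) := by rw [← Real.exp_add]; ring_nf
  have hBc1 : 1 ≤ Bc L a' a := one_le_Bc (L := L) ha'0 ha0
  have hBcn : Bc L a' a ^ (n + 1) ≤ Real.exp (4 * α) := by
    calc Bc L a' a ^ (n + 1) ≤ Real.exp (2 * (α / n)) ^ (n + 1) := pow_le_pow_left₀ (by linarith) hBc _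
      _ = Real.exp (((n + 1 : ℕ) : ℝ) * (2 * (α / n))) := by rw [← Real.exp_nat_mul]
      _ ≤ Real.exp (4 * α) := by
          refine Real.exp_le_exp.mpr ?_
          have : ((n + 1 : ℕ) : ℝ) ≤ 2 * n := by push_cast; linarith
          calc ((n + 1 : ℕ) : ℝ) * (2 * (α / n)) ≤ (2 * n) * (2 * (α / n)) := mul_le_mul_of_nonneg_right this (by positivity)
            _ = 4 * α := by field_simp; ring
  -- ξ, γ
  have hξ : xiC L a' ≤ α / n * Real.exp α := by
    unfold xiC
    calc (1 + a') ^ L - 1 ≤ Real.exp (α / n) - 1 := by linarith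
      _ ≤ α / n * Real.exp (α / n) := exp_sub_one_le_mul_exp' _
      _ ≤ α / n * Real.exp α := mul_le_mul_of_nonneg_left (Real.exp_le_exp.mpr hαn) (by positivity)
  have hξ0 : 0 ≤ xiC L a' := xiC_nonneg (L := L) ha'0
  have hγ : gam L a' b ≤ (α ^ 2 * Real.exp α / 2 + β) / n ^ 2 := by
    unfold gam
    have h1 := one_add_pow_sub_linear_le ha'0 L
    rw [eLa'] at h1
    rw [eLb]
    have h2 : (α / n) ^ 2 / 2 * (1 + a') ^ L ≤ (α / n) ^ 2 / 2 * Real.exp α := mul_le_mul_of_nonneg_left hE1' (by positivity)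
    have e : (α / n) ^ 2 / 2 * Real.exp α + β / n ^ 2 = (α ^ 2 * Real.exp α / 2 + β) / n ^ 2 := by field_simp
    linarith
  have hγ0 : 0 ≤ gam L a' b := gam_nonneg (L := L) ha'0 hb0
  -- Θ
  have hΘ : ThetaC L n a' a b ≤ Real.exp (4 * α) * (α ^ 2 * Real.exp α / 2 + β + α * Real.exp α) / n := by
    unfold ThetaC
    have hin : (n : ℝ) * gam L a' b + xiC L a' ≤ (α ^ 2 * Real.exp α / 2 + β + α * Real.exp α) / n := by
      have h1 : (n : ℝ) * gam L a' b ≤ (α ^ 2 * Real.exp α / 2 + β) / n := by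
        calc (n : ℝ) * gam L a' b ≤ n * ((α ^ 2 * Real.exp α / 2 + β) / n ^ 2) := mul_le_mul_of_nonneg_left hγ (by positivity)
          _ = (α ^ 2 * Real.exp α / 2 + β) / n := by field_simp
      have e : (α ^ 2 * Real.exp α / 2 + β) / n + α / n * Real.exp α = (α ^ 2 * Real.exp α / 2 + β + α * Real.exp α) / n := by
        field_simp
      linarith
    have hin0 : 0 ≤ (n : ℝ) * gam L a' b + xiC L a' := by positivity
    calc Bc L a' a ^ (n + 1) * ((n : ℝ) * gam L a' b + xiC L a')
        ≤ Real.exp (4 * α) * ((α ^ 2 * Real.exp α / 2 + β + α * Real.exp α) / n) :=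
          mul_le_mul hBcn hin hin0 (Real.exp_nonneg _)
      _ = _ := by ring
  have hΘ0 : 0 ≤ ThetaC L n a' a b := ThetaC_nonneg (L := L) (n := n) ha'0 ha0 hb0
  -- assembly
  unfold thetaC theta0
  have hin : ((d : ℝ) + 1) * ThetaC L n a' a b + 2 * xiC L a' + a
      ≤ (((d : ℝ) + 1) * Real.exp (4 * α) * (α ^ 2 * Real.exp α / 2 + β + α * Real.exp α) + 2 * (α * Real.exp α) + α) / n := by
    have h1 : ((d : ℝ) + 1) * ThetaC L n a' a b ≤ ((d : ℝ) + 1) * (Real.exp (4 * α) * (α ^ 2 * Real.exp α / 2 + β + α * Real.exp α) / n) :=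
      mul_le_mul_of_nonneg_left hΘ (by positivity)
    have h2 : 2 * xiC L a' ≤ 2 * (α / n * Real.exp α) := by linarith
    rw [haa]
    have e : ((d : ℝ) + 1) * (Real.exp (4 * α) * (α ^ 2 * Real.exp α / 2 + β + α * Real.exp α) / n) + 2 * (α / n * Real.exp α) + α / n
        = (((d : ℝ) + 1) * Real.exp (4 * α) * (α ^ 2 * Real.exp α / 2 + β + α * Real.exp α) + 2 * (α * Real.exp α) + α) / n := by
      field_simp
    linarith
  have hin0 : 0 ≤ ((d : ℝ) + 1) * ThetaC L n a' a b + 2 * xiC L a' + a := by positivity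
  calc Bl L n a' a ^ (d + 1) * (((d : ℝ) + 1) * ThetaC L n a' a b + 2 * xiC L a' + a)
      ≤ Real.exp (2 * (d + 1) * α)
          * ((((d : ℝ) + 1) * Real.exp (4 * α) * (α ^ 2 * Real.exp α / 2 + β + α * Real.exp α) + 2 * (α * Real.exp α) + α) / n) :=
        mul_le_mul hBld hin hin0 (Real.exp_nonneg _)
    _ = _ := by ring

end ClosedForm

/-! ## §4 The tower form: (ii) at every level `k` with the geometric bound `θ₀·L^{−k}` -/

section Tower

open scoped Matrix Matrix.Norms.L2Operator
open Literature.MathematicalPhysics.QuantumFieldTheory.Balaban1983to89.B5Prop11Plancherel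
open Literature.MathematicalPhysics.QuantumFieldTheory.Balaban1983to89.B5G183RateUnitTower (lev lev_neZero)
open Summit.QuantumFields.BalabanUV.T4Continuum.BalabanAveragedTowerUnit (idx cast_lev')
open Summit.QuantumFields.BalabanUV.T4Continuum.BalabanAveragedTowerModes (par)
open Summit.QuantumFields.BalabanUV.T4Continuum.BlockPairingGeometry (parT)
open Summit.QuantumFields.BalabanUV.T4Continuum.CovariantBlockAveraging (transport contour)
open Summit.QuantumFields.BalabanUV.T4Continuum.LineAveragingPairing (glue)
open Literature.MathematicalPhysics.QuantumFieldTheory.Balaban1983to89.T4EtaRateMin (LocalRate)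

variable (L : ℕ) [NeZero L] (M : Fin d → ℕ) [hM : ∀ μ, NeZero (M μ)] {o : Type*} [Fintype o] [DecidableEq o]

/-- **ROW B3.b-conc (ii) ALONG THE TOWER** `n_k = L^k`: for a tower of bond transporters `R k : Fin d → idx L M k → Matrix o o ℂ` with the
per-bond SIZE `‖R^{(k)}_ν(i) − 1‖ ≤ α/n_k` (the `RegularBackgroundTower`/`LipschitzBackgroundM.bound` shape) and the per-bond TWO-LEVEL
CONSISTENCY `‖n_{k+1}•(R^{(k+1)}_ν(i) − 1) − n_k•(R^{(k)}_ν(parT i) − 1)‖ ≤ β/n_k` (the `LipschitzBackgroundM.consistent` shape = NE3's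
currency via `Support/NE2FromNE3`), the contour transporters at adjacent levels satisfy leaf-07's `hT2` with the GEOMETRIC bound
`θ k = theta0 d α β · L^{−k}`. [folklore] -/
theorem transport_contour_two_level_tower {R : (k : ℕ) → Fin d → (idx L M k → Matrix o o ℂ)} {α β : ℝ} (hα : 0 ≤ α) (hβ : 0 ≤ β)
    (hsize : ∀ k ν i, ‖R k ν i - 1‖ ≤ α / (lev L k : ℕ))
    (hcons : ∀ k ν (i : idx L M (k + 1)),
      ‖(((lev L (k + 1) : ℕ) : ℂ)) • (R (k + 1) ν i - 1) - (((lev L k : ℕ) : ℂ)) • (R k ν (parT (lev L k) L M i) - 1)‖ ≤ β / (lev L k : ℕ))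
    (k : ℕ) (y : Tor M) (μ : Fin d) (j : Fin d → Fin (lev L k)) (r : Fin d → Fin L) (t' : ℕ) (ht' : t' < L * lev L k) :
    ‖transport (fine (lev L (k + 1)) M) (R (k + 1)) μ (contour (lev L (k + 1)) M y (glue (lev L k) L (j, r)) μ t')
        - transport (fine (lev L k) M) (R k) μ (contour (lev L k) M y j μ (((r μ : ℕ) + t') / L))‖
      ≤ theta0 d α β * ((L : ℝ)⁻¹) ^ k := by
  haveI := lev_neZero L k
  have hL : 1 ≤ L := Nat.pos_of_ne_zero (NeZero.ne L)
  have hn : 1 ≤ lev L k := Nat.pos_of_ne_zero (NeZero.ne (lev L k))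
  have hnr : (0 : ℝ) < (lev L k : ℕ) := by exact_mod_cast hn
  have hLr : (0 : ℝ) < L := by exact_mod_cast hL
  have hc' : (((lev L (k + 1) : ℕ) : ℂ)) = (L : ℂ) * (((lev L k : ℕ) : ℂ)) := by
    rw [BalabanAveragedTowerUnit.lev_succ']; push_cast; ring
  have hc'0 : (((lev L (k + 1) : ℕ) : ℂ)) ≠ 0 := by exact_mod_cast NeZero.ne (lev L (k + 1))
  have hnorm : ‖(((lev L (k + 1) : ℕ) : ℂ))‖ = (L : ℝ) * (lev L k : ℕ) := by
    rw [Complex.norm_natCast, BalabanAveragedTowerUnit.lev_succ']; push_cast; ring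
  -- the three per-bond hypotheses at levels (k+1, k)
  have hR' : ∀ ν i, ‖R (k + 1) ν i - 1‖ ≤ α / ((L : ℝ) * (lev L k : ℕ)) := fun ν i => by
    have h := hsize (k + 1) ν i
    rwa [BalabanAveragedTowerUnit.lev_succ', Nat.cast_mul] at h
  have hR : ∀ ν i, ‖R k ν i - 1‖ ≤ α / (lev L k : ℕ) := hsize k
  have hC : ∀ ν (x' : Tor (fine (L * lev L k) M)) (κ : Fin d),
      ‖(R (k + 1) ν (x', κ) - 1) - ((L : ℂ))⁻¹ • (R k ν (par (lev L k) L M x', κ) - 1)‖ ≤ β / ((L : ℝ) * ((lev L k : ℕ) : ℝ) ^ 2) := by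
    intro ν x' κ
    have h := consistency_div L hc' hc'0 (R (k + 1) ν (x', κ)) (R k ν (par (lev L k) L M x', κ)) (hcons k ν (x', κ))
    rw [hnorm] at h
    refine h.trans (le_of_eq ?_)
    field_simp
  have h := transport_contour_two_level (lev L k) L M (by positivity) (by positivity) (by positivity) hR' hR hC y μ j r t' ht'
  have hθ := thetaC_le_theta0_div (L := L) (n := lev L k) hL hn d hα hβ
  refine h.trans (hθ.trans (le_of_eq ?_))
  rw [cast_lev', inv_pow, div_eq_mul_inv]

omit hM in
/-- **leaf-07's `hTτ` AT EVERY LEVEL**: with the per-bond size `‖R_ν(i) − 1‖ ≤ α/n`, every contour transporter (`s ≤ n` line bonds) is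
within `τ = e^{(d+1)α} − 1` of the identity, UNIFORMLY in `n`. [folklore] -/
theorem norm_transport_contour_sub_one_le (n : ℕ) [NeZero n] {R : Fin d → (Tor (fine n M) × Fin d → Matrix o o ℂ)} {α : ℝ} (hα : 0 ≤ α)
    (hR : ∀ ν i, ‖R ν i - 1‖ ≤ α / n) (y : Tor M) (μ : Fin d) (j : Fin d → Fin n) {s : ℕ} (hs : s ≤ n) :
    ‖transport (fine n M) R μ (contour n M y j μ s) - 1‖ ≤ Real.exp ((d + 1 : ℕ) * α) - 1 := by
  have hn : 0 < n := Nat.pos_of_ne_zero (NeZero.ne n)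
  have h := CovariantBlockAveraging.norm_transport_sub_one_le (fine n M) (div_nonneg hα (Nat.cast_nonneg n)) hR μ
    (Γ := contour n M y j μ s) (RegularTransportersContour.length_contour_le_of_le n y j μ hs)
  exact h.trans (CovariantBlockAveraging.pow_sub_one_le_exp hα (d + 1) n hn)

/-- **leaf-03's `transport_contour_two_level_of_regular` MADE GEOMETRIC**: from the regularity class `RegularTransporters R α β` (row B5)
and node NE3's `LocalRate` on `regClass R` (row B6, a DISPLAYED binder — nothing of NE3 is proved), the contour transporters at adjacent
levels satisfy leaf-07's `hT2` with `θ k = theta0 d α βNE3 · L^{−k}`, `βNE3 = betaNE3 o C`. [folklore] -/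
theorem transport_contour_two_level_of_regular_geom {R : (k : ℕ) → Fin d → (idx L M k → Matrix o o ℂ)} {α β : ℝ}
    (hreg : RegularBackgroundTower.RegularTransporters L M R α β) {C : ℝ} (hC : 0 ≤ C)
    (hNE3 : LocalRate (NE2FromNE3.bgReadings L M (RegularBackgroundTower.regClass L M R)) C ((L : ℝ)⁻¹)) (k : ℕ) (y : Tor M) (μ : Fin d)
    (j : Fin d → Fin (lev L k)) (r : Fin d → Fin L) (t' : ℕ) (ht' : t' < L * lev L k) :
    ‖transport (fine (L * lev L k) M) (R (k + 1)) μ (contour (L * lev L k) M y (glue (lev L k) L (j, r)) μ t')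
        - transport (fine (lev L k) M) (R k) μ (contour (lev L k) M y j μ (((r μ : ℕ) + t') / L))‖
      ≤ theta0 d α (RegularBackgroundTower.betaNE3 o C) * ((L : ℝ)⁻¹) ^ k := by
  haveI := lev_neZero L k
  have hL : 1 ≤ L := Nat.pos_of_ne_zero (NeZero.ne L)
  have hn : 1 ≤ lev L k := Nat.pos_of_ne_zero (NeZero.ne (lev L k))
  have hb : 0 ≤ RegularBackgroundTower.betaNE3 o C := by unfold RegularBackgroundTower.betaNE3; positivity
  have h := RegularTransportersContour.transport_contour_two_level_of_regular hreg hC hNE3 k y μ j r t' ht'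
  have hθ := thetaC_le_theta0_div (L := L) (n := lev L k) hL hn d hreg.nonneg.1 hb
  refine h.trans (hθ.trans (le_of_eq ?_))
  rw [cast_lev', inv_pow, div_eq_mul_inv]

end Tower

end Summit.QuantumFields.BalabanUV.T4Continuum.NestedContourTransport

end
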